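import Summits.CriticalPhenomena.CardyFormulaZ2.Theorems.CardyComplexConeParafermionToSLESixFamiliesDiamondClassMorera
import HarnessLib

/-!
# Line `potential-darboux-picard-diamond`, conjunct (b′) of S3: the discrete Morera theorem for face potentials

Helper file of the conditional stub of S3 (b′) `ClosedClass` (`closedClass_of_edgeCoherence_edgePrecompact`) of crux
`ParafermionToSLESixFamilies` (stmt-CriticalPhenomena-11389), line `potential-darboux-picard-diamond`; continues the
toolkit `…DiamondClassMorera` (no percolation input).

**Discrete Morera** (`differentiableOn_of_faceLimit`, registered helper). Let `U ⊆ ℂ` be open, `0 < u_k → 0` meshes,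
`H_k` functions on the faces of `u_k ℤ²`, `z_k` constants and `G` continuous on `U` with `H_k − z_k → G` at the face
centres, uniformly on compacts of `U`. If the holomorphic vertex defects `T(v) = (i − 1)H(NE) − iH(NW) + H(SE)` are
`o(u_k)` in horizontal PAIRS `T(v) + T(v + e₀)`, uniformly on compacts, then `G` is holomorphic on `U`: for a closed
rectangle `R ⊆ U` discretised by `2N′_k × M_k` vertices (an even number of columns), `u_k Σ_R T` is `≤ ε · area` by
pairing and equals the discrete contour sum of `H_k` around `R` by telescoping, whose four sides are Riemann sums
converging to `∮_{∂R} G dz` (`rect_integral_eq_zero`); Morera concludes.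
-/

noncomputable section

namespace Summit.CriticalPhenomena.CardyFormulaZ2.Cruxes.ParafermionToSLESixFamilies.PotentialDarbouxPicardDiamond

open scoped Topology
open Filter Set Metric Complex
open Literature.Probability Literature.Probability.LatticeModels

/-! ## Rectangle integrals of a face-potential limit vanish -/

/-- `u Σ (X − z) − u Σ (Y − z) = u Σ (X − Y)`: the additive constants cancel between two sides with the same count. -/
theorem mul_sum_sub_mul_sum {ι : Type*} (s : Finset ι) (X Y : ι → ℂ) (u z : ℂ) :
    u * ∑ i ∈ s, (X i - z) - u * ∑ i ∈ s, (Y i - z) = u * ∑ i ∈ s, (X i - Y i) := by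
  rw [← mul_sub, ← Finset.sum_sub_distrib]
  congr 1
  exact Finset.sum_congr rfl fun i _ => by ring

/-- A non-negative real number below `ε C` for every `ε > 0` vanishes. -/
theorem eq_zero_of_forall_le_mul {x C : ℝ} (hx : 0 ≤ x) (h : ∀ ε > (0:ℝ), x ≤ ε * C) : x = 0 := by
  have ht : Tendsto (fun n : ℕ => (1 / ((n : ℝ) + 1)) * C) atTop (𝓝 (0 * C)) :=
    tendsto_one_div_add_atTop_nhds_zero_nat.mul_const C
  rw [zero_mul] at ht
  exact le_antisymm (ge_of_tendsto' ht fun n => h _ (by positivity)) hx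

/-- **The boundary integral of a face-potential limit over a sorted rectangle vanishes.** Setting: `U` open, meshes
`0 < u_k → 0`, face functions `H_k`, constants `z_k`, `G` continuous on `U` with `H_k − z_k → G` at the face centres
uniformly on compacts of `U`, and holomorphic vertex defects `o(u_k)` in horizontal pairs, uniformly on compacts. Then
`∫_a^b G(x + ic) dx − ∫_a^b G(x + id) dx + i ∫_c^d G(b + iy) dy − i ∫_c^d G(a + iy) dy = 0` for `[a,b] × [c,d] ⊆ U`.
Proof: discretise the rectangle by `2N′_k × M_k` vertices of `u_k ℤ²` (an EVEN number of columns); `u_k ×` the sum of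
the vertex defects is `≤ ε · area` by pairing, and by telescoping it is the discrete contour sum, whose four sides are
Riemann sums converging to the four side integrals. -/
theorem rect_integral_eq_zero {U : Set ℂ} (hU : IsOpen U) {u : ℕ → ℝ} (hu : ∀ k, 0 < u k)
    (hu0 : Tendsto u atTop (𝓝 0)) {H : ℕ → Site 2 → ℂ} {z : ℕ → ℂ} {G : ℂ → ℂ} (hG : ContinuousOn G U)
    (hlim : ∀ K : Set ℂ, IsCompact K → K ⊆ U → ∀ ε > (0:ℝ), ∀ᶠ k in atTop, ∀ f : Site 2,
      ctr (u k) f ∈ K → ‖H k f - z k - G (ctr (u k) f)‖ ≤ ε)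
    (hT : ∀ K : Set ℂ, IsCompact K → K ⊆ U → ∀ ε > (0:ℝ), ∀ᶠ k in atTop, ∀ v : Site 2,
      meshPoint (u k) v ∈ K → ‖vtxDefect (H k) v + vtxDefect (H k) (v + Pi.single 0 1)‖ ≤ ε * u k)
    {a b c d : ℝ} (hab : a ≤ b) (hcd : c ≤ d) (hRU : (Icc a b ×ℂ Icc c d) ⊆ U) :
    (∫ x in a..b, G (x + c * I)) - (∫ x in a..b, G (x + d * I)) + I * (∫ y in c..d, G (b + y * I)) -
      I * (∫ y in c..d, G (a + y * I)) = 0 := by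
  -- the compact neighbourhood `K` of the rectangle `R`
  set R : Set ℂ := Icc a b ×ℂ Icc c d with hR
  have hRc : IsCompact R := isCompact_Icc.reProdIm isCompact_Icc
  obtain ⟨ρ, hρ, hρU⟩ := hRc.exists_cthickening_subset_open hU hRU
  set K : Set ℂ := cthickening ρ R with hK
  have hKc : IsCompact K := hRc.cthickening
  have hGK : ContinuousOn G K := hG.mono hρU
  have memR : ∀ w : ℂ, a ≤ w.re → w.re ≤ b → c ≤ w.im → w.im ≤ d → w ∈ R := fun w h1 h2 h3 h4 =>
    ⟨⟨h1, h2⟩, ⟨h3, h4⟩⟩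
  have memK : ∀ w w' : ℂ, w' ∈ R → dist w w' ≤ ρ → w ∈ K := fun w w' hw' hd =>
    mem_cthickening_of_dist_le w w' ρ R hw' hd
  have dist_le_re_im : ∀ w w' : ℂ, dist w w' ≤ |w.re - w'.re| + |w.im - w'.im| := fun w w' => by
    rw [dist_eq_norm]; simpa using Complex.norm_le_abs_re_add_abs_im (w - w')
  have hlimK := hlim K hKc hρU
  -- lattice parameters at level `k`
  set m0 : ℕ → ℤ := fun k => ⌊a / u k⌋ with hm0
  set n0 : ℕ → ℤ := fun k => ⌊c / u k⌋ with hn0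
  set Nh : ℕ → ℕ := fun k => ⌊(b - a) / (2 * u k)⌋₊ with hNh
  set M : ℕ → ℕ := fun k => ⌊(d - c) / u k⌋₊ with hM
  set g : ℕ → Site 2 := fun k => fc 0 (m0 k) (n0 k) with hg
  have hm0b : ∀ k, u k * m0 k ≤ a ∧ a < u k * m0 k + u k := fun k => by
    have h1 := Int.floor_le (a / u k)
    have h2 := Int.lt_floor_add_one (a / u k)
    have e : u k * (a / u k) = a := mul_div_cancel₀ a (hu k).ne'
    constructor
    · calc u k * m0 k ≤ u k * (a / u k) := mul_le_mul_of_nonneg_left h1 (hu k).le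
        _ = a := e
    · calc a = u k * (a / u k) := e.symm
        _ < u k * (m0 k + 1) := mul_lt_mul_of_pos_left h2 (hu k)
        _ = u k * m0 k + u k := by ring
  have hn0b : ∀ k, u k * n0 k ≤ c ∧ c < u k * n0 k + u k := fun k => by
    have h1 := Int.floor_le (c / u k)
    have h2 := Int.lt_floor_add_one (c / u k)
    have e : u k * (c / u k) = c := mul_div_cancel₀ c (hu k).ne'
    constructor
    · calc u k * n0 k ≤ u k * (c / u k) := mul_le_mul_of_nonneg_left h1 (hu k).le
        _ = c := e
    · calc c = u k * (c / u k) := e.symm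
        _ < u k * (n0 k + 1) := mul_lt_mul_of_pos_left h2 (hu k)
        _ = u k * n0 k + u k := by ring
  have hNhb : ∀ k, 2 * u k * Nh k ≤ b - a ∧ b - a < 2 * u k * Nh k + 2 * u k := fun k => by
    have hp : 0 < 2 * u k := mul_pos two_pos (hu k)
    have h0 : 0 ≤ (b - a) / (2 * u k) := div_nonneg (sub_nonneg.2 hab) hp.le
    have h1 := Nat.floor_le h0
    have h2 := Nat.lt_floor_add_one ((b - a) / (2 * u k))
    have e : 2 * u k * ((b - a) / (2 * u k)) = b - a := mul_div_cancel₀ _ hp.ne'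
    constructor
    · calc 2 * u k * Nh k ≤ 2 * u k * ((b - a) / (2 * u k)) := mul_le_mul_of_nonneg_left h1 hp.le
        _ = b - a := e
    · calc b - a = 2 * u k * ((b - a) / (2 * u k)) := e.symm
        _ < 2 * u k * (Nh k + 1) := mul_lt_mul_of_pos_left h2 hp
        _ = 2 * u k * Nh k + 2 * u k := by ring
  have hMb : ∀ k, u k * M k ≤ d - c ∧ d - c < u k * M k + u k := fun k => by
    have h0 : 0 ≤ (d - c) / u k := div_nonneg (sub_nonneg.2 hcd) (hu k).le
    have h1 := Nat.floor_le h0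
    have h2 := Nat.lt_floor_add_one ((d - c) / u k)
    have e : u k * ((d - c) / u k) = d - c := mul_div_cancel₀ _ (hu k).ne'
    constructor
    · calc u k * M k ≤ u k * ((d - c) / u k) := mul_le_mul_of_nonneg_left h1 (hu k).le
        _ = d - c := e
    · calc d - c = u k * ((d - c) / u k) := e.symm
        _ < u k * (M k + 1) := mul_lt_mul_of_pos_left h2 (hu k)
        _ = u k * M k + u k := by ring
  -- coordinates of centres and vertices of the lattice rectangle
  have cre : ∀ k (s t : ℤ), (ctr (u k) (fc (g k) s t)).re = u k * m0 k + u k * s + u k / 2 := by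
    intro k s t; rw [ctr_re, fc_zero]; simp [hg]; ring
  have cim : ∀ k (s t : ℤ), (ctr (u k) (fc (g k) s t)).im = u k * n0 k + u k * t + u k / 2 := by
    intro k s t; rw [ctr_im, fc_one]; simp [hg]; ring
  have mre : ∀ k (s t : ℤ), (meshPoint (u k) (fc (g k) s t)).re = u k * m0 k + u k * s := by
    intro k s t; rw [meshPoint_re, fc_zero]; simp [hg]; ring
  have mim : ∀ k (s t : ℤ), (meshPoint (u k) (fc (g k) s t)).im = u k * n0 k + u k * t := by
    intro k s t; rw [meshPoint_im, fc_one]; simp [hg]; ring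
  -- limits of the counts, smallness of the mesh
  have hNlim : Tendsto (fun k => ((2 * Nh k : ℕ) : ℝ) * u k) atTop (𝓝 (b - a)) := by
    have hlow : Tendsto (fun k => b - a - 2 * u k) atTop (𝓝 (b - a)) := by
      have := (hu0.const_mul 2).const_sub (b - a); simpa using this
    refine tendsto_of_tendsto_of_tendsto_of_le_of_le hlow tendsto_const_nhds (fun k => ?_) (fun k => ?_)
    · have := (hNhb k).2; push_cast; linarith
    · have := (hNhb k).1; push_cast; linarith
  have hMlim : Tendsto (fun k => (M k : ℝ) * u k) atTop (𝓝 (d - c)) := by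
    have hlow : Tendsto (fun k => d - c - u k) atTop (𝓝 (d - c)) := by
      have := hu0.const_sub (d - c); simpa using this
    refine tendsto_of_tendsto_of_tendsto_of_le_of_le hlow tendsto_const_nhds (fun k => ?_) (fun k => ?_)
    · have := (hMb k).2; linarith
    · have := (hMb k).1; linarith
  have hsmall : ∀ᶠ k in atTop, 5 * u k ≤ ρ := by
    have := (hu0.const_mul 5).eventually (Iic_mem_nhds (show (5:ℝ) * 0 < ρ by simpa using hρ))
    exact this.mono fun k hk => hk
  -- columns: Riemann sums along vertical sides
  have col : ∀ (S : ℕ → ℤ) (x₀ : ℝ), x₀ ∈ Icc a b →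
      (∀ k, |u k * m0 k + u k * S k + u k / 2 - x₀| ≤ 3 * u k) →
      Tendsto (fun k => (u k : ℂ) * ∑ t ∈ Finset.range (M k),
        (H k (fc (g k) (S k) ((t + 1 : ℕ) : ℤ)) - z k)) atTop (𝓝 (∫ s in c..d, G (↑x₀ + ↑s * I))) := by
    intro S x₀ hx₀ hS
    have h := tendsto_faceSum hKc hGK hu hu0 hlimK (sub_nonneg.2 hcd) hMlim (by simp : ‖(I : ℂ)‖ = 1) hρ
      (p := (x₀ : ℂ)) (a₀ := c) (C := 5) (F := fun k t => fc (g k) (S k) ((t + 1 : ℕ) : ℤ)) ?_ (by norm_num) ?_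
    · rwa [show c + (d - c) = d by ring] at h
    · rintro _ ⟨s, hs, rfl⟩
      rw [show c + (d - c) + ρ = d + ρ by ring] at hs
      obtain ⟨y, hy, hsy⟩ := exists_near_Icc hcd hρ.le hs
      refine memK _ (↑x₀ + ↑y * I) (memR _ (by simpa using hx₀.1) (by simpa using hx₀.2)
        (by simpa using hy.1) (by simpa using hy.2)) ((dist_le_re_im _ _).trans ?_)
      simpa using hsy
    · filter_upwards [hsmall] with k hk t ht
      have htM : (t : ℝ) + 1 ≤ M k := by exact_mod_cast ht
      obtain ⟨hM1, -⟩ := hMb k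
      obtain ⟨hn1, hn2⟩ := hn0b k
      have ht0 : (0 : ℝ) ≤ t * u k := mul_nonneg (Nat.cast_nonneg t) (hu k).le
      have htu : (t : ℝ) * u k + u k ≤ d - c := by nlinarith [hu k]
      have tre : (↑x₀ + ↑(c + ↑t * u k) * I : ℂ).re = x₀ := by simp
      have tim : (↑x₀ + ↑(c + ↑t * u k) * I : ℂ).im = c + t * u k := by simp
      have hre : |(ctr (u k) (fc (g k) (S k) ((t + 1 : ℕ) : ℤ))).re - (↑x₀ + ↑(c + ↑t * u k) * I).re| ≤
          3 * u k := by
        rw [cre, tre]; exact hS k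
      have him : |(ctr (u k) (fc (g k) (S k) ((t + 1 : ℕ) : ℤ))).im - (↑x₀ + ↑(c + ↑t * u k) * I).im| ≤
          2 * u k := by
        rw [cim, tim, abs_le]; push_cast
        constructor <;> nlinarith
      have hd : dist (ctr (u k) (fc (g k) (S k) ((t + 1 : ℕ) : ℤ))) (↑x₀ + ↑(c + ↑t * u k) * I) ≤ 5 * u k :=
        (dist_le_re_im _ _).trans (by linarith)
      refine ⟨memK _ _ (memR _ ?_ ?_ ?_ ?_) (hd.trans hk), hd⟩
      · rw [tre]; exact hx₀.1
      · rw [tre]; exact hx₀.2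
      · rw [tim]; linarith
      · rw [tim]; linarith
  -- rows: Riemann sums along horizontal sides
  have row : ∀ (T : ℕ → ℤ) (y₀ : ℝ), y₀ ∈ Icc c d →
      (∀ k, |u k * n0 k + u k * T k + u k / 2 - y₀| ≤ 3 * u k) →
      Tendsto (fun k => (u k : ℂ) * ∑ s ∈ Finset.range (2 * Nh k),
        (H k (fc (g k) ((s + 1 : ℕ) : ℤ) (T k)) - z k)) atTop (𝓝 (∫ s in a..b, G (↑s + ↑y₀ * I))) := by
    intro T y₀ hy₀ hT'
    have h := tendsto_faceSum hKc hGK hu hu0 hlimK (sub_nonneg.2 hab) hNlim (by simp : ‖(1 : ℂ)‖ = 1) hρ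
      (p := (y₀ : ℂ) * I) (a₀ := a) (C := 5) (F := fun k s => fc (g k) ((s + 1 : ℕ) : ℤ) (T k)) ?_ (by norm_num) ?_
    · rw [show a + (b - a) = b by ring] at h
      have e : (fun s : ℝ => G (↑y₀ * I + ↑s * 1)) = fun s : ℝ => G (↑s + ↑y₀ * I) :=
        funext fun s => by congr 1; ring
      rwa [e] at h
    · rintro _ ⟨s, hs, rfl⟩
      rw [show a + (b - a) + ρ = b + ρ by ring] at hs
      obtain ⟨x, hx, hsx⟩ := exists_near_Icc hab hρ.le hs
      refine memK _ (↑x + ↑y₀ * I) (memR _ (by simpa using hx.1) (by simpa using hx.2)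
        (by simpa using hy₀.1) (by simpa using hy₀.2)) ((dist_le_re_im _ _).trans ?_)
      simpa using hsx
    · filter_upwards [hsmall] with k hk s hs
      have hsN : (s : ℝ) + 1 ≤ ((2 * Nh k : ℕ) : ℝ) := by exact_mod_cast hs
      obtain ⟨hN1, -⟩ := hNhb k
      obtain ⟨hm1, hm2⟩ := hm0b k
      have hs0 : (0 : ℝ) ≤ s * u k := mul_nonneg (Nat.cast_nonneg s) (hu k).le
      have hsu : (s : ℝ) * u k + u k ≤ b - a := by push_cast at hsN; nlinarith [hu k]
      have tre : (↑y₀ * I + ↑(a + ↑s * u k) * 1 : ℂ).re = a + s * u k := by simp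
      have tim : (↑y₀ * I + ↑(a + ↑s * u k) * 1 : ℂ).im = y₀ := by simp
      have hre : |(ctr (u k) (fc (g k) ((s + 1 : ℕ) : ℤ) (T k))).re - (↑y₀ * I + ↑(a + ↑s * u k) * 1).re| ≤
          2 * u k := by
        rw [cre, tre, abs_le]; push_cast
        constructor <;> nlinarith
      have him : |(ctr (u k) (fc (g k) ((s + 1 : ℕ) : ℤ) (T k))).im - (↑y₀ * I + ↑(a + ↑s * u k) * 1).im| ≤
          3 * u k := by
        rw [cim, tim]; exact hT' k
      have hd : dist (ctr (u k) (fc (g k) ((s + 1 : ℕ) : ℤ) (T k))) (↑y₀ * I + ↑(a + ↑s * u k) * 1) ≤ 5 * u k :=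
        (dist_le_re_im _ _).trans (by linarith)
      refine ⟨memK _ _ (memR _ ?_ ?_ ?_ ?_) (hd.trans hk), hd⟩
      · rw [tre]; linarith
      · rw [tre]; linarith
      · rw [tim]; exact hy₀.1
      · rw [tim]; exact hy₀.2
  -- the four sides
  have hSr := col (fun k => ((2 * Nh k : ℕ) : ℤ)) b ⟨hab, le_rfl⟩ fun k => by
    obtain ⟨h1, h2⟩ := hm0b k; obtain ⟨h3, h4⟩ := hNhb k
    rw [abs_le]; push_cast; constructor <;> nlinarith [hu k]
  have hSl := col (fun _ => ((0 : ℕ) : ℤ)) a ⟨le_rfl, hab⟩ fun k => by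
    obtain ⟨h1, h2⟩ := hm0b k
    rw [abs_le]; push_cast; constructor <;> nlinarith [hu k]
  have hSt := row (fun k => ((M k : ℕ) : ℤ)) d ⟨hcd, le_rfl⟩ fun k => by
    obtain ⟨h1, h2⟩ := hn0b k; obtain ⟨h3, h4⟩ := hMb k
    rw [abs_le]; push_cast; constructor <;> nlinarith [hu k]
  have hSb := row (fun _ => ((0 : ℕ) : ℤ)) c ⟨le_rfl, hcd⟩ fun k => by
    obtain ⟨h1, h2⟩ := hn0b k
    rw [abs_le]; push_cast; constructor <;> nlinarith [hu k]
  -- the telescoped identity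
  set Sr : ℕ → ℂ := fun k => (u k : ℂ) * ∑ t ∈ Finset.range (M k),
    (H k (fc (g k) ((2 * Nh k : ℕ) : ℤ) ((t + 1 : ℕ) : ℤ)) - z k) with hSrd
  set Sl : ℕ → ℂ := fun k => (u k : ℂ) * ∑ t ∈ Finset.range (M k),
    (H k (fc (g k) ((0 : ℕ) : ℤ) ((t + 1 : ℕ) : ℤ)) - z k) with hSld
  set St : ℕ → ℂ := fun k => (u k : ℂ) * ∑ s ∈ Finset.range (2 * Nh k),
    (H k (fc (g k) ((s + 1 : ℕ) : ℤ) ((M k : ℕ) : ℤ)) - z k) with hStd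
  set Sb : ℕ → ℂ := fun k => (u k : ℂ) * ∑ s ∈ Finset.range (2 * Nh k),
    (H k (fc (g k) ((s + 1 : ℕ) : ℤ) ((0 : ℕ) : ℤ)) - z k) with hSbd
  have hid : ∀ k, (u k : ℂ) * ∑ s ∈ Finset.range (2 * Nh k), ∑ t ∈ Finset.range (M k),
      vtxDefect (H k) (fc (g k) ((s + 1 : ℕ) : ℤ) ((t + 1 : ℕ) : ℤ)) = I * (Sr k - Sl k) - (St k - Sb k) := by
    intro k
    simp only [hSrd, hSld, hStd, hSbd]
    rw [mul_sum_sub_mul_sum, mul_sum_sub_mul_sum, sum_vtxDefect]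
    ring
  -- the pairing bound
  have hbd : ∀ ε > (0:ℝ), ∀ᶠ k in atTop, ‖I * (Sr k - Sl k) - (St k - Sb k)‖ ≤ ε * ((b - a) / 2 * (d - c)) := by
    intro ε hε
    filter_upwards [hT R hRc hRU ε hε] with k hk
    rw [← hid k, norm_mul, Complex.norm_real, Real.norm_of_nonneg (hu k).le]
    obtain ⟨hm1, hm2⟩ := hm0b k
    obtain ⟨hn1, hn2⟩ := hn0b k
    obtain ⟨hN1, -⟩ := hNhb k
    obtain ⟨hM1, -⟩ := hMb k
    have hpair : ∀ j < Nh k, ∀ t < M k,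
        ‖vtxDefect (H k) (fc (g k) ((2 * j + 1 : ℕ) : ℤ) ((t + 1 : ℕ) : ℤ)) +
          vtxDefect (H k) (fc (g k) ((2 * j + 2 : ℕ) : ℤ) ((t + 1 : ℕ) : ℤ))‖ ≤ ε * u k := by
      intro j hj t ht
      have hj' : (2 * j + 1 : ℝ) + 1 ≤ 2 * (Nh k : ℝ) := by exact_mod_cast (show 2 * j + 2 ≤ 2 * Nh k by omega)
      have ht' : (t : ℝ) + 1 ≤ M k := by exact_mod_cast ht
      have hv := hk (fc (g k) ((2 * j + 1 : ℕ) : ℤ) ((t + 1 : ℕ) : ℤ)) (memR _ ?_ ?_ ?_ ?_)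
      · rwa [fc_add_e0, show ((2 * j + 1 : ℕ) : ℤ) + 1 = ((2 * j + 2 : ℕ) : ℤ) by push_cast; ring] at hv
      · rw [mre]; push_cast; nlinarith [hu k]
      · rw [mre]; push_cast; nlinarith [hu k]
      · rw [mim]; push_cast; nlinarith [hu k]
      · rw [mim]; push_cast; nlinarith [hu k]
    have hsum := norm_sum_sum_le_of_pair (X := fun s t => vtxDefect (H k) (fc (g k) s t)) hpair
    have hNu : u k * Nh k ≤ (b - a) / 2 := by linarith
    have hMu : u k * M k ≤ d - c := hM1
    calc u k * ‖∑ s ∈ Finset.range (2 * Nh k), ∑ t ∈ Finset.range (M k),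
          vtxDefect (H k) (fc (g k) ((s + 1 : ℕ) : ℤ) ((t + 1 : ℕ) : ℤ))‖
        ≤ u k * (Nh k * M k * (ε * u k)) := mul_le_mul_of_nonneg_left hsum (hu k).le
      _ = ε * ((u k * Nh k) * (u k * M k)) := by ring
      _ ≤ ε * ((b - a) / 2 * (d - c)) :=
          mul_le_mul_of_nonneg_left (mul_le_mul hNu hMu (mul_nonneg (hu k).le (Nat.cast_nonneg _))
            (by linarith)) hε.le
  -- the limit
  have hL : Tendsto (fun k => I * (Sr k - Sl k) - (St k - Sb k)) atTop
      (𝓝 (I * ((∫ s in c..d, G (↑b + ↑s * I)) - ∫ s in c..d, G (↑a + ↑s * I)) -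
        ((∫ s in a..b, G (↑s + ↑d * I)) - ∫ s in a..b, G (↑s + ↑c * I)))) :=
    ((hSr.sub hSl).const_mul I).sub (hSt.sub hSb)
  have hzero : I * ((∫ s in c..d, G (↑b + ↑s * I)) - ∫ s in c..d, G (↑a + ↑s * I)) -
      ((∫ s in a..b, G (↑s + ↑d * I)) - ∫ s in a..b, G (↑s + ↑c * I)) = 0 := by
    rw [← norm_eq_zero]
    exact eq_zero_of_forall_le_mul (norm_nonneg _) fun ε hε =>
      le_of_tendsto ((continuous_norm.tendsto _).comp hL) (hbd ε hε)
  linear_combination hzero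

/-- **Discrete Morera for face potentials** (registered helper of S3 (b′)). Let `U ⊆ ℂ` be open, `0 < u_k → 0`,
`H_k : ℤ² → ℂ` face functions, `z_k` constants and `G` continuous on `U` such that `H_k − z_k → G` at the face centres
`ctr (u k) f`, uniformly on every compact `K ⊆ U`; if the holomorphic vertex defects are `o(u_k)` in horizontal pairs,
uniformly on compacts (`‖T(v) + T(v + e₀)‖ ≤ ε u_k` eventually, for every `ε`), then `G` is holomorphic on `U`. -/
theorem differentiableOn_of_faceLimit : ∀ {U : Set ℂ}, IsOpen U → ∀ {u : ℕ → ℝ}, (∀ k, 0 < u k) → Tendsto u atTop (𝓝 0) → ∀ {H : ℕ → Site 2 → ℂ} {z : ℕ → ℂ} {G : ℂ → ℂ}, ContinuousOn G U → (∀ K : Set ℂ, IsCompact K → K ⊆ U → ∀ ε > (0:ℝ), ∀ᶠ k in atTop, ∀ f : Site 2, ctr (u k) f ∈ K → ‖H k f - z k - G (ctr (u k) f)‖ ≤ ε) → (∀ K : Set ℂ, IsCompact K → K ⊆ U → ∀ ε > (0:ℝ), ∀ᶠ k in atTop, ∀ v : Site 2, meshPoint (u k) v ∈ K → ‖vtxDefect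 (H k) v + vtxDefect (H k) (v + Pi.single 0 1)‖ ≤ ε * u k) → DifferentiableOn ℂ G U := by
  intro U hU u hu hu0 H z G hG hlim hT
  exact differentiableOn_of_rect_integral hU hG fun a b c d hab hcd hRU =>
    rect_integral_eq_zero hU hu hu0 hG hlim hT hab hcd hRU

end Summit.CriticalPhenomena.CardyFormulaZ2.Cruxes.ParafermionToSLESixFamilies.PotentialDarbouxPicardDiamond

end
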